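import Summits.ResolutionOfSingularities.ResolutionOfSingularities.Theorems.ResidueCutCertificates
import Summits.ResolutionOfSingularities.ResolutionOfSingularities.Theorems.MaxContactCutOddCrossCut
import HarnessLib

/-!
# MaxContactCutResidueCut — decomp-res node «ResidueCut» (lens-2 g25, critic row 200 CLEARED MAP +1), tree file 4/4 of the node

Content VERBATIM from the decomp-res lens-2 g25 node `HOME/decomp-res-lens-2/g25/ResidueCut.lean` (pin 4d29427b; no
carry, imports the landed tree only; ns `…Theses.ResidueCut` ↦ `…Theorems.ResidueCut`); HOME =
run/shared/lean/pub/decomp-res; critic CRITIC-LEDGER row 200 CLEARED MAP +1; landing orders INBOX 08:49:37Z /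
08:52:28Z / 09:07:12Z — provenance, critic text and the lens header in full in the first file of the node,
`ResidueCutLaws`.  `--kind proof --supports stmt-ResolutionOfSingularities-29273`.

## This file

THE WIRING of the node VERBATIM, BY NAME on the host route `MaxContactCut` (Theses cone), in lens order:
`rungOne_iff_cutA` · `rungOne_iff_wild` · `closesA` · `ResX.rungOne_iff` · `ResX.closes` ·
`ResX.oddResSpecialRung_of_rungOne` · `ResX.closes_of_engines` — CUT A by name (`rungOne_iff_wild :
MaxContactCut.RungOne ⟺ RungOneWild`, `closesA`), `namespace ResX` (§6: `OddResSpecialRung`,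
`oddSpecialRung_iff_res` / `_resSpecialRung`, `rungOne_iff`, **`closes`** `: OddX.OddGenericRung →
ResWildSpecialRung oddLeaf → MaxContactCut.RungOne`, `closes_of_engines`).  Imports the last cone-free part it needs
+ `MaxContactCutOddCrossCut`; 0 sorry.

[WRITER NOTE (decomp-res writer g13): file split only (tree files ≤ 400 lines); sections, namespaces, section
`open`s and every declaration exactly as in the lens (the node's HOME-only dupNamespace-linter line is dropped; the
namespace-level `open` lines of the node are replayed in every part, the `open …Theses` line only in the Theses-cone
file `MaxContactCutResidueCut`); namespace renamed `…Theses.ResidueCut` ↦ `…Theorems.ResidueCut`.]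

(Sources: EGAIV4 Thm. 16.11.2; StacksProject 00TV; CossartPiltant2008 Prop. 4.2; VillamayorU2008ReesDiff §4.1;
BierstoneGrigorievMilmanWlodarczyk2011 §3.1; Cutkosky2009; Hironaka1964 Ch. III; Kollar2007 Lemma 3.74; Hauser2003 §4.)
-/

open CategoryTheory AlgebraicGeometry TopologicalSpace IsLocalRing
open Literature.AlgebraicGeometry.Resolution
open Summit.ResolutionOfSingularities.ResolutionOfSingularities.Theorems
open Summit.ResolutionOfSingularities.ResolutionOfSingularities.Theorems.WeakOrderReduction
open Summit.ResolutionOfSingularities.ResolutionOfSingularities.Theorems.ForcedTowerClasses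
open Summit.ResolutionOfSingularities.ResolutionOfSingularities.Theorems.CurveLeafExit
open Summit.ResolutionOfSingularities.ResolutionOfSingularities.Theorems.PurityCut
open Summit.ResolutionOfSingularities.ResolutionOfSingularities.Theorems.AbsoluteContactClasses
open Summit.ResolutionOfSingularities.ResolutionOfSingularities.Theorems.DeltaFaceCutClasses
open Summit.ResolutionOfSingularities.ResolutionOfSingularities.Theorems.RelativeDeltaCut
open Summit.ResolutionOfSingularities.ResolutionOfSingularities.Theorems.DeepCrossCut
open Summit.ResolutionOfSingularities.ResolutionOfSingularities.Theorems.PinchCut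
open Summit.ResolutionOfSingularities.ResolutionOfSingularities.Theorems.JetCut
open Summit.ResolutionOfSingularities.ResolutionOfSingularities.Theorems.SplitCut
open Summit.ResolutionOfSingularities.ResolutionOfSingularities.Theorems.CylinderCut
open Summit.ResolutionOfSingularities.ResolutionOfSingularities.Theorems.SpreadCut
open Summit.ResolutionOfSingularities.ResolutionOfSingularities.Theorems.CrossCut
open Summit.ResolutionOfSingularities.ResolutionOfSingularities.Theorems.OddCrossCut
open Summit.ResolutionOfSingularities.ResolutionOfSingularities.Theses

namespace Summit.ResolutionOfSingularities.ResolutionOfSingularities.Theorems.ResidueCut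

/-- EXACT CUT A at the rung: `RungOne ⟺ RungOnePerfCoprime ∧ RungOneWild` (pure logic). [folklore] -/
theorem rungOne_iff_cutA : MaxContactCut.RungOne ↔ RungOnePerfCoprime ∧ RungOneWild :=
  ⟨fun h => ⟨fun hE2 n hn => (seqDimFour_iff_slices.mp (h hE2 n hn)).1,
      fun hE2 n hn => (seqDimFour_iff_slices.mp (h hE2 n hn)).2⟩,
    fun ⟨hP, hW⟩ hE2 n hn => seqDimFour_iff_slices.mpr ⟨hP hE2 n hn, hW hE2 n hn⟩⟩

/-- **EXACT RE-LOCATION (hypothesis-free): `RungOne ⟺ RungOneWild`.** [folklore] -/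
theorem rungOne_iff_wild : MaxContactCut.RungOne ↔ RungOneWild :=
  ⟨fun h => (rungOne_iff_cutA.mp h).2, fun h => rungOne_iff_cutA.mpr ⟨rungOnePerfCoprime_holds, h⟩⟩

/-- **`closesA`** — the column target BY NAME from the residual of CUT A alone. [folklore] -/
theorem closesA (hW : RungOneWild) : MaxContactCut.RungOne := rungOne_iff_wild.mpr hW

namespace ResX

open Res

/-- **`rungOne_iff` — `RungOne ⟺ OddGenericRung ∧ OddResSpecialRung`** (tree `OddX.rungOne_iff` ∘ CUT A ∘ CUT B). [folklore] -/
theorem rungOne_iff : MaxContactCut.RungOne ↔ OddX.OddGenericRung ∧ OddResSpecialRung :=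
  OddX.rungOne_iff.trans (and_congr_right fun _ => oddSpecialRung_iff_res)

/-- **`closes` — the column target BY NAME**: the tree's decided odd half and the g25 residual give
`MaxContactCut.RungOne`. [folklore] -/
theorem closes (hG : OddX.OddGenericRung) (hS : OddResSpecialRung) : MaxContactCut.RungOne :=
  OddX.closes hG (oddSpecialRung_iff_res.mpr hS)

/-- The residual is implied by the column target (it IS a piece of it). [folklore] -/
theorem oddResSpecialRung_of_rungOne (h : MaxContactCut.RungOne) : OddResSpecialRung :=
  oddSpecialRung_iff_res.mp (OddX.oddSpecialRung_of_rungOne h)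

/-- **`closes_of_engines`** — `RungOne` from the g25 residual modulo the lineage's named engine hypotheses of the odd
level (tree `OddX.closes_of_engines` verbatim). [folklore] -/
theorem closes_of_engines (hV : VeryNearCutClasses.VeryNearExit) (hD : DeltaPackageExit)
    (hU : UniformCurvePackageExit) (hR : RelCurvePackageExit) (hN : NormalConeJumpExit)
    (hM : MonomialPinchExit) (hC : FlatConeExit) (hGE : GrandExit) (hSE : SplitConeExit)
    (hJE : JetCylinderExit) (hX : MaxContactCut.MaxOrderThreefoldResolution) (hΓE : SpreadExit) (hXE : CrossExit)
    (hDXE : DeepCrossExit) (hNE : NodeExit) (hOXE : OddCrossExit)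
    (hP : ∀ n : ℕ, 2 ≤ n → ComponentPackagePort n) (h1 : FaceFormCutClasses.OrderOneContact)
    (hS : OddResSpecialRung) : MaxContactCut.RungOne :=
  OddX.closes_of_engines hV hD hU hR hN hM hC hGE hSE hJE hX hΓE hXE hDXE hNE hOXE hP h1 (oddSpecialRung_iff_res.mpr hS)

end ResX

end Summit.ResolutionOfSingularities.ResolutionOfSingularities.Theorems.ResidueCut
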